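import Literature.NumberTheory.ComplexMultiplication.FiniteQAlgebraLatticeRadicalProjectionInjective
import Literature.NumberTheory.ComplexMultiplication.FiniteQAlgebraLatticeClassesFinite
import Mathlib.RingTheory.Ideal.Quotient.Nilpotent
import Mathlib.RingTheory.Nilpotent.Lemmas
import HarnessLib

/-!
# `G([Λ]_ε)` IS FINITE FOR EVERY `A` — Hertling–Larabi 2026 Remarks 9.3 (iii) (= Theorem 6.5 on the invertible
# exact `Λ`-ideals): the `ε`-classes of invertible full lattices with exact order `Λ` form a finite set, for an
# ARBITRARY finite-dimensional commutative `ℚ`-algebra `A` (nilpotents allowed), by Faddeev's injectivity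
# `G([Λ]_ε) ↪ G([pr_FΛ]_ε)` and the Jordan–Zassenhaus theorem in the separable quotient `F = A/R`

[topic NumberTheory/ComplexMultiplication] General-`A` series (namespace
`Literature.NumberTheory.ComplexMultiplication.FiniteQAlgebraLattice`); sequel of
`FiniteQAlgebraLatticeRadicalProjectionInjective` (Thm. 9.2 ∕ 5.10 injectivity [Fa68] for a surjective ring
homomorphism with nil kernel) and `FiniteQAlgebraLatticeClassesFinite` (Thm. 6.3, Jordan–Zassenhaus for separable
= reduced `A`; its docstring: «NOT here: HL 2026 Thm. 6.5 (finiteness of the classes of EXACT `Λ`-ideals for every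
`A`)» — supplied here for the INVERTIBLE exact `Λ`-ideals, i.e. for the group `G([Λ]_ε)`).  Lane `lit-hodgefound`
(Track 2 foundations library), seat p19 generation 37, row g37-#8.  THEOREMS ONLY: no definition, no instance, no
notation, no named fact (D-0026, net Literature debt `0`), no `sorry`.

DEF-FREE SPELLING (as in the files above).  «`L ∈ G(Λ)`» is `IsFullLattice A L ∧ L / L = Λ ∧ L * ((L / L) / L) =
L / L`; the set of `ε`-classes `{[L]_ε | L ∈ G(Λ)}` is the quotient TYPE
`Quot fun L L' : {L // L ∈ G(Λ)} => ∃ u : Aˣ, u • L.1 = L'.1` (exactly as `FiniteQAlgebraLatticeClassesFinite`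
spells `{[L]_ε | 𝒪(L) ⊇ Λ}`), and «finite» is `Finite` of that type — equivalently (§3) a `Finset` of lattices
meeting every `ε`-class of `G(Λ)`.  HL's `pr_F : A = F ⊕ R → F` is ANY surjective ring homomorphism `π : A → B`
with nil kernel in §1 and the quotient map `A → A ⧸ nilradical A` (`B = A/R ≅ F` reduced) in §2.

## Sources, VERBATIM

C. Hertling, K. Larabi, *Semigroups from full lattices in commutative ℚ-algebras*, arXiv:2602.14973 (2026)
[HertlingLarabi2026], held `paper:arxiv-2602.14973`, §9 (chunk p0024): «`G([Λ]_ε) → G([Λ_0]_ε),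
[L]_ε ↦ [pr_FL]_ε` (9.7) […] **Remarks 9.3.** […] (iii) The second group `G([Λ_0]_ε)` in (9.7) is finite by the
Jordan-Zassenhaus Theorem 6.3. Therefore also the first group `G([Λ]_ε)` in (9.7) is finite. We know this already
from Theorem 6.5. But the equality of the sizes of the two groups is new. (iv) By (5.13) any `w`-equivalence class
of `ε`-classes `[L]_ε` of full lattices `L` with `𝒪(L) = Λ` is in bijection to `G([Λ]_ε)`, so finite. Therefore we
would obtain a second proof of Theorem 6.5 […]»; §6 (chunk p0015): «**Theorem 6.3.** (Special case of the
Jordan-Zassenhaus theorem) Let `A` be separable. For any order `Λ` in `A` the set `{[L]_ε | L ∈ 𝓛(A), 𝒪(L) ⊃ Λ}`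
of `ε`-classes of `Λ`-ideals is finite. […] **Theorem 6.5.** Let `A` be as in Theorem 3.1, so `A` is a finite
dimensional commutative `ℚ`-algebra with unit element. For any order `Λ` in `A`, the set
`{[L]_ε | L ∈ 𝓛(A), 𝒪(L) = Λ}` of `ε`-classes of exact `Λ`-ideals is finite.» and Step 1 of its proof (chunk
p0016): «there is a natural isomorphism `F ≅ R^{[0]} = R^0/R^1 = A/R`. […] `Λ^{[0]}` is an order in `F`. If `L` is
an exact `Λ`-ideal then the full lattice `L^{[0]}` in `F` is a `Λ^{[0]}`-ideal (but not necessarily an exact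
`Λ^{[0]}`-ideal). An `ε`-class of full lattices in `A` projects by `L ↦ L^{[0]}` to an `ε`-class of full lattices in
`F`. By the Jordan-Zassenhaus theorem 6.3 the set of `ε`-classes of `Λ^{[0]}`-ideals in `F` is finite».

C. Hertling, K. Larabi, *Conjugacy classes of regular integer matrices*, arXiv:2602.15748 (2026)
[HertlingLarabi2026b], held `paper:arxiv-2602.15748`, §5 before Thm. 5.10 (chunk p0010): «the finite group
`G([Λ]_ε)` for an order `Λ` in `A` is isomorphic to the finite group `G([Λ_0]_ε)` for the induced order
`Λ_0 = pr_FΛ` in the separable part `F` of `A`.»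

## The proof

`[L]_ε ↦ [πL]_ε` maps the classes of `G(Λ)` to `ε`-classes of full `πΛ`-ideals of `B` (`πL` is full,
`πL·πΛ = π(LΛ) ⊆ πL`; `π(uL) = π(u)πL`), INJECTIVELY by Faddeev's theorem
(`FiniteQAlgebraLatticeRadicalProjectionInjective.exists_units_smul_eq_of_map_eq_units_smul_map_of_div_self_eq`:
`πL_2 = f·πL_1`, `L_1, L_2 ∈ G(Λ)` ⟹ `L_2 = uL_1`); for `B = A/nilradical(A)` (reduced, finite-dimensional) the
target is finite by Thm. 6.3 (`FiniteQAlgebraLatticeClassesFinite.finite_quot_isFullLattice_of_isReduced`).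

## What is proved

* §1 **`finite_quot_invertible_of_finite_quot_map`** — for a surjective ring homomorphism `π : A → B` with nil
  kernel: if the `ε`-classes of full `πΛ`-ideals of `B` are finite, the `ε`-classes of `G(Λ)` are finite
  (Rem. 9.3 (iii) «Therefore also the first group `G([Λ]_ε)` in (9.7) is finite»).
* §2 **`finite_quot_invertible`** — REMARKS 9.3 (iii) ∕ THEOREM 6.5 on `G(Λ)`: for EVERY finite-dimensional
  commutative `ℚ`-algebra `A` and every full lattice `Λ`, the `ε`-classes of invertible full lattices `L` with
  `𝒪(L) = Λ` form a finite type.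
* §3 **`exists_finset_forall_invertible_exists_units_smul_mem`** — the same as a finite system of representatives:
  a `Finset T` of lattices with `uL ∈ T` for every `L ∈ G(Λ)` and some unit `u`.
NOT here: Thm. 6.5 for the NON-invertible exact `Λ`-ideals (HL's Steps 2–3, socle filtration), and the equality
`|G([Λ]_ε)| = |G([Λ_0]_ε)|` (needs the surjectivity of (9.7), i.e. a multiplicative section of `A → A/R`).

## References

* [HertlingLarabi2026] C. Hertling, K. Larabi, arXiv:2602.14973 (2026), §9 Rem. 9.3 (iii) (chunk p0024), §6
  Thm. 6.3, Thm. 6.5 and Step 1 of its proof (chunks p0015–p0016). [cite: HertlingLarabi2026, §9 Rem. 9.3 (iii), chunk p0024]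
* [HertlingLarabi2026b] C. Hertling, K. Larabi, arXiv:2602.15748 (2026), §5 before Thm. 5.10 (chunk p0010).
  [cite: HertlingLarabi2026b, §5 Thm. 5.10 (preamble), chunk p0010]
* [Faddeev1968] D. K. Faddeev, Equivalence of systems of integer matrices, Amer. Math. Soc. Transl. (2) 71 (1968)
  43–48 (the injectivity, as cited by [HertlingLarabi2026] Thm. 9.2). [cite: Faddeev1968, as cited by HertlingLarabi2026 §9 Thm. 9.2]
-/

noncomputable section

open scoped Pointwise
open Module Function Submodule

open Literature.NumberTheory.Automorphic (IsFullLattice mem_units_smul_submodule_iff)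
open Literature.LinearAlgebra.Matrix.LatimerMacDuffeeSquarefree (equivalence_exists_units_smul)

namespace Literature.NumberTheory.ComplexMultiplication.FiniteQAlgebraLattice

/-! ## §1 `[L]_ε ↦ [πL]_ε` is injective on `G([Λ]_ε)`: finiteness descends along `π` -/

section Map

variable {A B : Type} [CommRing A] [CommRing B] [Algebra ℚ A]

/-- **REMARKS 9.3 (iii), the mechanism: for a surjective ring homomorphism `π : A → B` whose kernel consists of
nilpotent elements and a lattice `Λ ⊂ A`, if the `ε`-classes of full `πΛ`-ideals `M ⊂ B` (`M·πΛ ⊆ M`) are finite,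
then the `ε`-classes of `G(Λ)` (invertible full lattices `L` with `𝒪(L) = Λ`) are finite** — `[L]_ε ↦ [πL]_ε` is
well defined («An `ε`-class of full lattices in `A` projects […] to an `ε`-class of full lattices in `F`»; `πL` is a
full `πΛ`-ideal) and INJECTIVE on `G([Λ]_ε)` by Faddeev's theorem [Fa68] («The second group `G([Λ_0]_ε)` in (9.7)
is finite […]. Therefore also the first group `G([Λ]_ε)` in (9.7) is finite»).
[cite: HertlingLarabi2026, §9 Rem. 9.3 (iii) with Thm. 9.2, chunk p0024] [cite: HertlingLarabi2026, §6 proof of Thm. 6.5, Step 1, chunk p0016]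
[cite: Faddeev1968, as cited by HertlingLarabi2026 §9 Thm. 9.2] -/
theorem finite_quot_invertible_of_finite_quot_map {π : A →+* B} (hπ : Surjective π)
    (hnil : ∀ x, π x = 0 → IsNilpotent x) {Λ : Submodule ℤ A}
    (hfin : Finite (Quot fun M M' : {M : Submodule ℤ B // IsFullLattice B M ∧
        ∀ m ∈ M, ∀ a ∈ Λ.map (π : A →+ B).toIntLinearMap, m * a ∈ M} => ∃ u : Bˣ, u • M.1 = M'.1)) :
    Finite (Quot fun L L' : {L : Submodule ℤ A //
        IsFullLattice A L ∧ L / L = Λ ∧ L * ((L / L) / L) = L / L} => ∃ u : Aˣ, u • L.1 = L'.1) := by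
  -- `πL` is a full `πΛ`-ideal
  have hP : ∀ L : Submodule ℤ A, IsFullLattice A L ∧ L / L = Λ ∧ L * ((L / L) / L) = L / L →
      IsFullLattice B (L.map (π : A →+ B).toIntLinearMap) ∧
        ∀ m ∈ L.map (π : A →+ B).toIntLinearMap, ∀ a ∈ Λ.map (π : A →+ B).toIntLinearMap,
          m * a ∈ L.map (π : A →+ B).toIntLinearMap := by
    rintro L ⟨hL, hO, -⟩
    refine ⟨isFullLattice_map_of_surjective hπ hL, fun m hm a ha => ?_⟩
    have h : L * Λ ≤ L := mul_le.2 fun l hl b hb => by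
      rw [← hO] at hb
      rw [mul_comm]
      exact (mem_div_iff_forall_mul_mem.1 hb) l hl
    exact map_mono h (by rw [map_mul_eq_map_mul_map]; exact mul_mem_mul hm ha)
  -- `F : [L] ↦ [πL]`
  obtain ⟨F, hF1⟩ : ∃ F : {L : Submodule ℤ A // IsFullLattice A L ∧ L / L = Λ ∧ L * ((L / L) / L) = L / L} →
      {M : Submodule ℤ B // IsFullLattice B M ∧
        ∀ m ∈ M, ∀ a ∈ Λ.map (π : A →+ B).toIntLinearMap, m * a ∈ M},
      ∀ L, (F L).1 = L.1.map (π : A →+ B).toIntLinearMap :=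
    ⟨fun L => ⟨_, hP L.1 L.2⟩, fun L => rfl⟩
  have hF : ∀ ⦃L₁ L₂ : {L : Submodule ℤ A // IsFullLattice A L ∧ L / L = Λ ∧ L * ((L / L) / L) = L / L}⦄,
      (∃ u : Aˣ, u • L₁.1 = L₂.1) → ∃ u' : Bˣ, u' • (F L₁).1 = (F L₂).1 := by
    rintro L₁ L₂ ⟨u, hu⟩
    exact ⟨Units.map (π : A →* B) u, by rw [hF1, hF1, ← hu, map_units_smul]⟩
  -- injective by Faddeev's theorem
  have hinj : Function.Injective (Quot.map F hF :
      Quot (fun L L' : {L : Submodule ℤ A // IsFullLattice A L ∧ L / L = Λ ∧ L * ((L / L) / L) = L / L} =>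
          ∃ u : Aˣ, u • L.1 = L'.1) →
        Quot fun M M' : {M : Submodule ℤ B // IsFullLattice B M ∧
          ∀ m ∈ M, ∀ a ∈ Λ.map (π : A →+ B).toIntLinearMap, m * a ∈ M} => ∃ u : Bˣ, u • M.1 = M'.1) := by
    rintro ⟨L₁⟩ ⟨L₂⟩ h
    obtain ⟨u', hu'⟩ := (equivalence_exists_units_smul _).eqvGen_iff.1 (Quot.eqvGen_exact h)
    rw [hF1, hF1] at hu'
    obtain ⟨u, hu⟩ := exists_units_smul_eq_of_map_eq_units_smul_map_of_div_self_eq hπ hnil L₁.2.1 L₂.2.1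
      L₁.2.2.2 L₂.2.2.2 (L₁.2.2.1.trans L₂.2.2.1.symm) hu'.symm
    exact Quot.sound ⟨u, hu⟩
  exact Finite.of_injective _ hinj

end Map

/-! ## §2 Remarks 9.3 (iii) ∕ Theorem 6.5 on `G(Λ)`: `G([Λ]_ε)` is finite for every `A` -/

section Finite

variable {A : Type} [CommRing A] [Algebra ℚ A]

/-- **REMARKS 9.3 (iii) ∕ THEOREM 6.5 for the invertible exact `Λ`-ideals: for EVERY finite-dimensional commutative
`ℚ`-algebra `A` (nilpotent elements allowed) and every full lattice `Λ`, the `ε`-classes `{[L]_ε | L ∈ G(Λ)}` of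
invertible full lattices `L` with `𝒪(L) = Λ` form a FINITE set** — «The second group `G([Λ_0]_ε)` in (9.7) is
finite by the Jordan-Zassenhaus Theorem 6.3. Therefore also the first group `G([Λ]_ε)` in (9.7) is finite. We know
this already from Theorem 6.5»; here `pr_F` is `A → A/nilradical(A)` («`F ≅ A/R`», Step 1 of the proof of
Thm. 6.5), reduced and finite-dimensional, where Thm. 6.3 is
`FiniteQAlgebraLatticeClassesFinite.finite_quot_isFullLattice_of_isReduced`.
[cite: HertlingLarabi2026, §9 Rem. 9.3 (iii), chunk p0024] [cite: HertlingLarabi2026, §6 Thm. 6.5 (the classes in `G([Λ]_ε)`), chunk p0015]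
[cite: HertlingLarabi2026b, §5 («the finite group `G([Λ]_ε)`», before Thm. 5.10), chunk p0010] -/
theorem finite_quot_invertible [Module.Finite ℚ A] {Λ : Submodule ℤ A} (hΛ : IsFullLattice A Λ) :
    Finite (Quot fun L L' : {L : Submodule ℤ A //
        IsFullLattice A L ∧ L / L = Λ ∧ L * ((L / L) / L) = L / L} => ∃ u : Aˣ, u • L.1 = L'.1) := by
  haveI : IsReduced (A ⧸ nilradical A) :=
    (Ideal.isRadical_iff_quotient_reduced _).1 (Ideal.radical_isRadical _)
  haveI : Module.Finite ℚ (A ⧸ nilradical A) :=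
    Module.Finite.of_surjective (Ideal.Quotient.mkₐ ℚ (nilradical A)).toLinearMap
      (Ideal.Quotient.mkₐ_surjective ℚ _)
  exact finite_quot_invertible_of_finite_quot_map (π := Ideal.Quotient.mk (nilradical A))
    Ideal.Quotient.mk_surjective (fun x hx => mem_nilradical.1 (Ideal.Quotient.eq_zero_iff_mem.1 hx))
    (finite_quot_isFullLattice_of_isReduced _
      (isFullLattice_map_of_surjective Ideal.Quotient.mk_surjective hΛ))

/-! ## §3 The same as a finite system of representatives -/

/-- **`G([Λ]_ε)` is finite, as a finite system of representatives: for every finite-dimensional commutative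
`ℚ`-algebra `A` and every full lattice `Λ` there is a finite set `T` of lattices such that every invertible full
lattice `L` with `𝒪(L) = Λ` satisfies `uL ∈ T` for some unit `u`.**
[cite: HertlingLarabi2026, §9 Rem. 9.3 (iii) and §6 Thm. 6.5, chunks p0024, p0015] -/
theorem exists_finset_forall_invertible_exists_units_smul_mem [Module.Finite ℚ A] {Λ : Submodule ℤ A}
    (hΛ : IsFullLattice A Λ) :
    ∃ T : Finset (Submodule ℤ A), ∀ L : Submodule ℤ A, IsFullLattice A L → L / L = Λ →
      L * ((L / L) / L) = L / L → ∃ u : Aˣ, u • L ∈ T := by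
  classical
  haveI := finite_quot_invertible hΛ
  letI := Fintype.ofFinite (Quot fun L L' : {L : Submodule ℤ A //
    IsFullLattice A L ∧ L / L = Λ ∧ L * ((L / L) / L) = L / L} => ∃ u : Aˣ, u • L.1 = L'.1)
  refine ⟨Finset.univ.image fun q : Quot (fun L L' : {L : Submodule ℤ A //
      IsFullLattice A L ∧ L / L = Λ ∧ L * ((L / L) / L) = L / L} => ∃ u : Aˣ, u • L.1 = L'.1) => (Quot.out q).1,
    fun L hL hO hinv => ?_⟩
  have e := Quot.out_eq (Quot.mk (fun L L' : {L : Submodule ℤ A //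
      IsFullLattice A L ∧ L / L = Λ ∧ L * ((L / L) / L) = L / L} => ∃ u : Aˣ, u • L.1 = L'.1) ⟨L, hL, hO, hinv⟩)
  obtain ⟨u, hu⟩ := (equivalence_exists_units_smul _).eqvGen_iff.1 (Quot.eqvGen_exact e)
  exact ⟨u⁻¹, Finset.mem_image.2 ⟨Quot.mk _ ⟨L, hL, hO, hinv⟩, Finset.mem_univ _, eq_inv_smul_iff.2 hu⟩⟩

end Finite

end Literature.NumberTheory.ComplexMultiplication.FiniteQAlgebraLattice
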